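import Mathlib
import Summits.NavierStokesRegularity.NavierStokesRegularity.Theorems.EulerZoomLiouvillePowerGaugeEulerLiouvilleDSSFiniteNodesMemberPointwise
import HarnessLib.Audit

/-!
# Crux E `PowerGaugeEulerLiouville` (stmt-NavierStokesRegularity-19832): NON-DEGENERATE PERMANENT NODES ARE FINITELY MANY PER BALL —
# the finite-nodes DSS stratum with the finiteness hypothesis replaced by linear non-degeneracy of the self-similar particle paths
# (width seat ns-cas-k2 g3, lane «DSS thin vortical nodes», tool C part 4)

Route `EulerZoomLiouville` (NavierStokesRegularity), crux E.  A permanent node `y*` of an `l`-DSS classical member is a common zero of the phase fields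
`G_t(y) := u(t,(−t)ⁿy) + n(−t)^{n−1}y` (`t < 0`); call it NON-DEGENERATE if at SOME phase `t` the derivative `DG_t(y*)` is injective.  Non-degenerate zeros are
isolated, the permanent nodes of a closed ball form a compact set, so:
* `eq_of_hasFDerivAt_of_antilipschitz` — a point where a map has an injective (bounded-below) derivative is an isolated point of its level set;
* `exists_bound_of_injective` — an injective operator on `ℝ³` is bounded below;
* **`finite_permanentNodes_of_nondegenerate`** — if every permanent node of the ball `‖y‖ ≤ R` is non-degenerate, they are FINITELY MANY;
* **`ae_eq_zero_of_gauge_of_dss_of_clock_nondegenerateNodes_pointwise`** — the member theorem of `…DSSFiniteNodesMemberPointwise` with `hfin` replaced by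
  non-degeneracy: tame `l`-DSS + pressure clock + (core bounds ∨ p-DSS law) + every permanent node non-degenerate + pointwise strict subcriticality at the
  NON-VORTICAL permanent nodes ⇒ `u = 0` a.e.  TEXT FOR THE SKELETON (alternative to the finiteness conjunct):
  `∀ y : E3, (∀ t < 0, u t ((-t)^(2+ρ)⁻¹ • y) = …) → ∃ t : ℝ, t < 0 ∧ Function.Injective (fderiv ℝ (fun z : E3 => u t ((-t)^(2+ρ)⁻¹ • z) + ((2+ρ)⁻¹ * (-t)^((2+ρ)⁻¹-1)) • z) y)`.

WHAT THIS IS NOT: not NS regularity, not the crux E — a stratum of hypothetical DSS blow-up members; 19832 is OPEN. [folklore]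
-/

noncomputable section

set_option linter.dupNamespace false

open MeasureTheory Set Filter Topology Metric Function
open scoped NNReal ENNReal ContDiff InnerProductSpace RealInnerProductSpace

namespace Summit.NavierStokesRegularity.NavierStokesRegularity.Theorems.PowerGaugeEulerLiouville.DSSNodes

open Literature.Analysis Literature.Analysis.FluidPDE Literature.Analysis.FunctionSpaces
open Summit.NavierStokesRegularity.NavierStokesRegularity.Theorems.PowerGaugeEulerLiouville.SimilarityBernoulli

variable {u : ℝ → EuclideanSpace ℝ (Fin 3) → EuclideanSpace ℝ (Fin 3)} {p : ℝ → EuclideanSpace ℝ (Fin 3) → ℝ} {θ ρ l : ℝ}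

/-! ### Isolated zeros -/

/-- **A bounded-below derivative isolates the level set**: `HasFDerivAt G A y*` with `c‖v‖ ≤ ‖Av‖` (`c > 0`) ⇒ for some `δ > 0`, the only solution of
`G y = G y*` in `B(y*, δ)` is `y*`. [folklore] -/
theorem eq_of_hasFDerivAt_of_antilipschitz {G : EuclideanSpace ℝ (Fin 3) → EuclideanSpace ℝ (Fin 3)}
    {A : EuclideanSpace ℝ (Fin 3) →L[ℝ] EuclideanSpace ℝ (Fin 3)} {ys : EuclideanSpace ℝ (Fin 3)} (hG : HasFDerivAt G A ys)
    {c : ℝ} (hc : 0 < c) (hA : ∀ v, c * ‖v‖ ≤ ‖A v‖) :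
    ∃ δ : ℝ, 0 < δ ∧ ∀ y, dist y ys < δ → G y = G ys → y = ys := by
  have h := hG.isLittleO.bound (half_pos hc)
  obtain ⟨δ, hδ, hball⟩ := Metric.eventually_nhds_iff.1 h
  refine ⟨δ, hδ, fun y hy hGy => ?_⟩
  have h1 := hball hy
  rw [hGy, sub_self, zero_sub, norm_neg] at h1
  have h2 := hA (y - ys)
  have h3 : ‖y - ys‖ ≤ 0 := by nlinarith [norm_nonneg (y - ys)]
  have h4 : ‖y - ys‖ = 0 := le_antisymm h3 (norm_nonneg _)
  rwa [norm_eq_zero, sub_eq_zero] at h4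

/-- An injective operator on `ℝ³` is bounded below. [folklore] -/
theorem exists_bound_of_injective {A : EuclideanSpace ℝ (Fin 3) →L[ℝ] EuclideanSpace ℝ (Fin 3)} (hA : Function.Injective A) :
    ∃ c : ℝ, 0 < c ∧ ∀ v, c * ‖v‖ ≤ ‖A v‖ := by
  have hker : LinearMap.ker (A : EuclideanSpace ℝ (Fin 3) →ₗ[ℝ] EuclideanSpace ℝ (Fin 3)) = ⊥ := LinearMap.ker_eq_bot.2 hA
  obtain ⟨K, hK0, hK⟩ := LinearMap.exists_antilipschitzWith (A : EuclideanSpace ℝ (Fin 3) →ₗ[ℝ] EuclideanSpace ℝ (Fin 3)) hker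
  refine ⟨(K : ℝ)⁻¹, by positivity, fun v => ?_⟩
  have h := hK.le_mul_dist v 0
  simp only [dist_zero_right, ContinuousLinearMap.coe_coe, map_zero] at h
  rw [inv_mul_le_iff₀ (by exact_mod_cast hK0)]
  exact h

/-! ### Non-degenerate permanent nodes of a ball are finitely many -/

/-- **NON-DEGENERATE PERMANENT NODES ARE FINITELY MANY PER BALL.**  `(u,p)` classical on `(−∞,0)`; if every permanent node `y*` with `‖y*‖ ≤ R` has, at some phase
`t < 0`, an injective derivative of the phase field `z ↦ u(t,(−t)ⁿz) + n(−t)^{n−1}z` at `y*`, then these nodes form a finite set (compact and discrete). [folklore] -/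
theorem finite_permanentNodes_of_nondegenerate (hcl : IsClassicalEulerSolutionOn (Iio 0) 0 u p) {R : ℝ}
    (hnd : ∀ y : EuclideanSpace ℝ (Fin 3), ‖y‖ ≤ R →
      (∀ t : ℝ, t < 0 → u t ((-t) ^ (2 + ρ)⁻¹ • y) = (-((2 + ρ)⁻¹ * (-t) ^ ((2 + ρ)⁻¹ - 1))) • y) →
      ∃ t : ℝ, t < 0 ∧ Function.Injective
        (fderiv ℝ (fun z : EuclideanSpace ℝ (Fin 3) => u t ((-t) ^ (2 + ρ)⁻¹ • z) + ((2 + ρ)⁻¹ * (-t) ^ ((2 + ρ)⁻¹ - 1)) • z) y)) :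
    {y : EuclideanSpace ℝ (Fin 3) | ‖y‖ ≤ R ∧
      ∀ t : ℝ, t < 0 → u t ((-t) ^ (2 + ρ)⁻¹ • y) = (-((2 + ρ)⁻¹ * (-t) ^ ((2 + ρ)⁻¹ - 1))) • y}.Finite := by
  set n : ℝ := (2 + ρ)⁻¹ with hn
  set PN : Set (EuclideanSpace ℝ (Fin 3)) := {y | ‖y‖ ≤ R ∧
    ∀ t : ℝ, t < 0 → u t ((-t) ^ n • y) = (-(n * (-t) ^ (n - 1))) • y} with hPN
  -- compactness (as in `SimilarityBernoulli.exists_subcritical_const_of_pointwise`)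
  have hPNc : IsCompact PN := by
    have hclosed : IsClosed {y : EuclideanSpace ℝ (Fin 3) |
        ∀ t : ℝ, t < 0 → u t ((-t) ^ n • y) = (-(n * (-t) ^ (n - 1))) • y} := by
      have e : {y : EuclideanSpace ℝ (Fin 3) | ∀ t : ℝ, t < 0 → u t ((-t) ^ n • y) = (-(n * (-t) ^ (n - 1))) • y} =
          ⋂ t ∈ Iio (0 : ℝ), {y | u t ((-t) ^ n • y) = (-(n * (-t) ^ (n - 1))) • y} := by
        ext y; simp [mem_iInter]
      rw [e]
      refine isClosed_biInter fun t ht => ?_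
      have hu : Continuous (u t) := ((hcl.contDiff_velocity ht).of_le (by norm_cast)).continuous
      exact isClosed_eq (hu.comp (continuous_const_smul ((-t) ^ n))) (continuous_const_smul (-(n * (-t) ^ (n - 1))))
    have h2 : PN = closedBall 0 R ∩ {y : EuclideanSpace ℝ (Fin 3) |
        ∀ t : ℝ, t < 0 → u t ((-t) ^ n • y) = (-(n * (-t) ^ (n - 1))) • y} := by
      rw [hPN]; ext y; simp
    rw [h2]
    exact (isCompact_closedBall _ _).inter_right hclosed
  -- discreteness: each node is isolated among the zeros of its non-degenerate phase field
  have hdisc : IsDiscrete PN := by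
    rw [isDiscrete_iff_forall_mem_exists_isOpen]
    intro y hy
    obtain ⟨t, ht, hinj⟩ := hnd y hy.1 hy.2
    set G : EuclideanSpace ℝ (Fin 3) → EuclideanSpace ℝ (Fin 3) :=
      fun z => u t ((-t) ^ n • z) + (n * (-t) ^ (n - 1)) • z with hGdef
    have hGd : Differentiable ℝ G := by
      have hu : Differentiable ℝ (u t) := ((hcl.contDiff_velocity ht).of_le (by norm_cast)).differentiable one_ne_zero
      exact (hu.comp (differentiable_id.const_smul ((-t) ^ n))).add (differentiable_id.const_smul (n * (-t) ^ (n - 1)))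
    obtain ⟨c, hc, hcA⟩ := exists_bound_of_injective hinj
    obtain ⟨δ, hδ, hiso⟩ := eq_of_hasFDerivAt_of_antilipschitz (hGd y).hasFDerivAt hc hcA
    refine ⟨ball y δ, isOpen_ball, ?_⟩
    ext z
    simp only [mem_inter_iff, mem_ball, mem_singleton_iff]
    constructor
    · rintro ⟨hz, hzPN⟩
      refine hiso z hz ?_
      -- both are zeros of `G`
      have hGz : G z = 0 := by
        simp only [hGdef]; rw [hzPN.2 t ht]; module
      have hGy : G y = 0 := by
        simp only [hGdef]; rw [hy.2 t ht]; module
      rw [hGz, hGy]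
    · rintro rfl
      exact ⟨mem_ball_self hδ, hy⟩
  exact hPNc.finite hdisc

/-! ### The member theorem with non-degenerate nodes -/

/-- **TAME DSS MEMBERS WITH A SUB-BERNOULLI PRESSURE CLOCK, NON-DEGENERATE PERMANENT NODES AND POINTWISE SUBCRITICAL NON-VORTICAL NODES ARE TRIVIAL.**
As `ae_eq_zero_of_gauge_of_dss_of_clock_finiteNodes_pointwise`, the finiteness of the permanent nodes per ball being DERIVED from their linear non-degeneracy
(`finite_permanentNodes_of_nondegenerate`). [folklore] -/
theorem ae_eq_zero_of_gauge_of_dss_of_clock_nondegenerateNodes_pointwise (hρ : 0 < ρ)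
    {H : ℝ → EuclideanSpace ℝ (Fin 3) → EuclideanSpace ℝ (Fin 3) →L[ℝ] EuclideanSpace ℝ (Fin 3)} {c₀ : ℝ≥0}
    (hsw : IsSuitableWeakSolutionOn (slab (EuclideanSpace ℝ (Fin 3)) (Iio 0) isOpen_Iio) 0 0 u p)
    (hH : HasWeakSpatialGradientOn (slab (EuclideanSpace ℝ (Fin 3)) (Iio 0) isOpen_Iio) u H)
    (hgauge : ∀ a : ℝ, 0 < a →
      ENNReal.ofReal (a ^ (2 * ρ)) * cknA a (0 : ℝ × EuclideanSpace ℝ (Fin 3)) u +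
          ENNReal.ofReal (a ^ ρ) * cknE a (0 : ℝ × EuclideanSpace ℝ (Fin 3)) H +
        ENNReal.ofReal (a ^ (2 * ρ)) * cknD a (0 : ℝ × EuclideanSpace ℝ (Fin 3)) p ≤ (c₀ : ℝ≥0∞))
    (hcl : IsClassicalEulerSolutionOn (Iio 0) 0 u p) (hl : 1 < l)
    (hdss : ∀ τ : ℝ, τ < 0 → ∀ y, u τ y = (l ^ (1 + ρ)) • u ((l ^ (2 + ρ)) * τ) (l • y))
    (htame : ∀ s t : ℝ, s < t → t < 0 → ∃ B : ℝ, ∀ τ ∈ Icc s t, ∀ y : EuclideanSpace ℝ (Fin 3),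
      ‖u τ y‖ ≤ B ∧ ‖fderiv ℝ (u τ) y‖ ≤ B)
    (hθ : θ < 1)
    (hclock : ∀ s : ℝ, s < 0 → ∀ x : EuclideanSpace ℝ (Fin 3),
      (-s) * timeDerivWithin (Iio 0) p s x - (2 + ρ)⁻¹ * fderiv ℝ (p s) x x - 2 * (1 - (2 + ρ)⁻¹) * p s x ≤
        θ * (1 - 2 * (2 + ρ)⁻¹) * ‖u s x + ((2 + ρ)⁻¹ / (-s)) • x‖ ^ 2)
    (hP : (∀ R : ℝ, 0 < R → ∃ P₀ G : ℝ, ∀ s : ℝ, s < 0 → ∀ x : EuclideanSpace ℝ (Fin 3), ‖x‖ ≤ R * (-s) ^ (2 + ρ)⁻¹ →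
        (-s) ^ (2 - 2 * (2 + ρ)⁻¹) * p s x ≤ P₀ ∧ (-s) ^ (2 - (2 + ρ)⁻¹) * ‖gradient (p s) x‖ ≤ G) ∨
      (∀ τ : ℝ, τ < 0 → ∀ y, p τ y = l ^ (2 + 2 * ρ) * p ((l ^ (2 + ρ)) * τ) (l • y)))
    (hnd : ∀ y : EuclideanSpace ℝ (Fin 3),
      (∀ t : ℝ, t < 0 → u t ((-t) ^ (2 + ρ)⁻¹ • y) = (-((2 + ρ)⁻¹ * (-t) ^ ((2 + ρ)⁻¹ - 1))) • y) →
      ∃ t : ℝ, t < 0 ∧ Function.Injective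
        (fderiv ℝ (fun z : EuclideanSpace ℝ (Fin 3) => u t ((-t) ^ (2 + ρ)⁻¹ • z) + ((2 + ρ)⁻¹ * (-t) ^ ((2 + ρ)⁻¹ - 1)) • z) y))
    (hnodes : ∀ y : EuclideanSpace ℝ (Fin 3),
      (∀ t : ℝ, t < 0 → u t ((-t) ^ (2 + ρ)⁻¹ • y) = (-((2 + ρ)⁻¹ * (-t) ^ ((2 + ρ)⁻¹ - 1))) • y) →
      (∀ t : ℝ, t < 0 → curl (u t) ((-t) ^ (2 + ρ)⁻¹ • y) = 0) →
      ∀ t : ℝ, t < 0 → ∀ v : EuclideanSpace ℝ (Fin 3), v ≠ 0 →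
        (-t) * ⟪fderiv ℝ (u t) ((-t) ^ (2 + ρ)⁻¹ • y) v, v⟫ < ‖v‖ ^ 2) :
    uncurry u =ᵐ[volume.restrict (Iio (0 : ℝ) ×ˢ (univ : Set (EuclideanSpace ℝ (Fin 3))))] 0 :=
  ae_eq_zero_of_gauge_of_dss_of_clock_finiteNodes_pointwise hρ hsw hH hgauge hcl hl hdss htame hθ hclock hP
    (fun _ => finite_permanentNodes_of_nondegenerate hcl fun y _ hperm => hnd y hperm) hnodes

end Summit.NavierStokesRegularity.NavierStokesRegularity.Theorems.PowerGaugeEulerLiouville.DSSNodes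

end
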